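import Summits.AtomisticToContinuum.Crystallization.Theses.DisclinationRation

/-!
# `FiveFoldRation` (stmt-AtomisticToContinuum-15799), negative side: the fcc witness and the
# registered stub `stub_dr5_shellMutual` is FALSE as typed

Crux `DisclinationRation.FiveFoldRation` (K2 of route DisclinationRation): for every `δ > 0` and every
`δ`-separated, relatively dense `S ⊆ ℝ³` all of whose points are `1/20`-good in the alphabet
{fcc, hcp, decahedral axis}, the points that are not `1/20`-{fcc,hcp}-good have density zero uniformly
on balls.  This file is negative-side support (refuter seat refuter-cdisprove-stmt-AtomisticToContinuum-15799-0,
2026-08-17); no route item is concluded positively.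

1. THE FCC WITNESS (`fccSet`, `fcc_separated`, `fcc_relDense`, `fcc_good`).  The three hypotheses of the
   crux are SATISFIABLE, by a kernel-checked inhabitant: the fcc lattice `D₃/√2` is `1`-separated, has
   covering radius `≤ 3`, and EVERY site is `1/20`-fcc-good in the crux's own inline sense — nearest-
   neighbour distance `d_y = sInf {dist z y : z ∈ S ∖ {y}} = 1` (`sInf_dist_fcc`), first shell
   `{z ∈ S : z ≠ y, dist z y < 13/10 · d_y}` = the translate of `fccKissingPattern` (`fcc_shell_iff`, by the
   integer enumeration `mem_fccInt_of_sqNormInt_le`: a non-zero even-sum vector of squared norm `≤ 3` is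
   one of the twelve `(±1,±1,0)`-permutations), matching `A = id`, `e : t ↦ t − y`, error `0 ≤ 1/20`.
   (On this witness the crux's conclusion holds trivially — no site is counted — so it is a non-vacuity
   witness, not a counterexample; it is the object every `…_false_without_…` / `…_false` lemma on this
   crux needs.)
2. TARGET (line `Sketch`, lead prover-line-stmt-AtomisticToContinuum-15799-0): the registered stub
   `stub_dr5_shellMutual` (FRONT END 1: gap structure, shell symmetry, scale comparability) is FALSE AS
   TYPED — `stub_dr5_shellMutual_false : ¬ StubShellMutualSig`, where `StubShellMutualSig` is the verbatim
   `Sig.stub_dr5_shellMutual` of `Cruxes/FiveFoldRation/Lines/Sketch.lean` (2026-08-17T14:23Z).  Cause: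
   VARIABLE CAPTURE — the scale at `z` is written `sInf ((fun z => dist z z) '' (S ∖ {z}))`, whose binder
   shadows `z`, so it is the infimum of the constant `0` (`sInf_capture`), and the conclusion's conjunct
   `dist y z < 13/10 · d_z` reads `dist y z < 0`.  Witness: `S = fccSet`, `y = 0`, `z = (1,1,0)/√2`.
   The same captured text is the FIRST HYPOTHESIS of the registered `stub_dr5_poleLemma` and
   `stub_dr5_core`, which are therefore vacuous as typed.  REPAIR (stub-misstated, not a defect of the
   line): write `sInf ((fun w => dist w z) '' (S ∖ {z}))`; with that the statement is IdeatorOne's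
   `ShellMutual` plus `d_y ≤ dist ≤ 21/20·d_y` both ways, to which the refuter has no objection.
-/

noncomputable section

namespace Summit.AtomisticToContinuum.Crystallization.Theorems.FiveFoldRation.Negative

open Literature.Geometry.DiscreteGeometry

/-! ### The fcc lattice at nearest-neighbour distance `1` -/

/-- The face-centred cubic point set `D₃/√2 = {v/√2 : v ∈ ℤ³, v₀ + v₁ + v₂ even}`, scaled to
nearest-neighbour distance `1`. [cite: ConwaySloane1999, Ch. 4 §6.3] -/
def fccSet : Set (EuclideanSpace ℝ (Fin 3)) :=
  {x | ∃ v : Fin 3 → ℤ, Even (v 0 + v 1 + v 2) ∧ x = (Real.sqrt 2)⁻¹ • intVec v}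

/-- Coordinate sums add. [folklore] -/
theorem even_sum_add {v w : Fin 3 → ℤ} (hv : Even (v 0 + v 1 + v 2)) (hw : Even (w 0 + w 1 + w 2)) :
    Even ((v + w) 0 + (v + w) 1 + (v + w) 2) := by
  have : (v + w) 0 + (v + w) 1 + (v + w) 2 = (v 0 + v 1 + v 2) + (w 0 + w 1 + w 2) := by
    simp only [Pi.add_apply]; ring
  rw [this]; exact hv.add hw

/-- Coordinate sums subtract. [folklore] -/
theorem even_sum_sub {v w : Fin 3 → ℤ} (hv : Even (v 0 + v 1 + v 2)) (hw : Even (w 0 + w 1 + w 2)) :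
    Even ((v - w) 0 + (v - w) 1 + (v - w) 2) := by
  have : (v - w) 0 + (v - w) 1 + (v - w) 2 = (v 0 + v 1 + v 2) - (w 0 + w 1 + w 2) := by
    simp only [Pi.sub_apply]; ring
  rw [this]; exact hv.sub hw

/-- The minimal vector `(1,1,0)`. [folklore] -/
def e110 : Fin 3 → ℤ := ![1, 1, 0]

/-- `(1,1,0)` has even coordinate sum. [folklore] -/
theorem e110_even : Even (e110 0 + e110 1 + e110 2) := by decide

/-- `|(1,1,0)|² = 2`. [folklore] -/
theorem sqNormInt_e110 : sqNormInt e110 = 2 := by decide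

/-- Distances in the scaled lattice are `√(|v − w|²)/√2`. [folklore] -/
theorem dist_smul_intVec (v w : Fin 3 → ℤ) :
    dist ((Real.sqrt 2)⁻¹ • intVec v : (EuclideanSpace ℝ (Fin 3))) ((Real.sqrt 2)⁻¹ • intVec w)
      = (Real.sqrt 2)⁻¹ * Real.sqrt (sqNormInt (v - w) : ℝ) := by
  rw [dist_eq_norm, ← smul_sub, intVec_sub, norm_smul, norm_inv,
    Real.norm_of_nonneg (Real.sqrt_nonneg 2), norm_intVec]

/-- A non-zero integer vector has positive squared norm. [folklore] -/
theorem sqNormInt_pos {u : Fin 3 → ℤ} (hu : u ≠ 0) : 0 < sqNormInt u := by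
  rcases lt_or_ge 0 (sqNormInt u) with h | h
  · exact h
  · exfalso
    unfold sqNormInt at h
    have h0 : u 0 ^ 2 = 0 := by nlinarith [sq_nonneg (u 0), sq_nonneg (u 1), sq_nonneg (u 2)]
    have h1 : u 1 ^ 2 = 0 := by nlinarith [sq_nonneg (u 0), sq_nonneg (u 1), sq_nonneg (u 2)]
    have h2 : u 2 ^ 2 = 0 := by nlinarith [sq_nonneg (u 0), sq_nonneg (u 1), sq_nonneg (u 2)]
    apply hu
    funext i
    fin_cases i <;> simp_all [pow_eq_zero_iff]

/-- Minimal vectors of `D₃` have squared norm `≥ 2`. [cite: ConwaySloane1999, Ch. 4 §6.3] -/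
theorem two_le_sqNormInt {u : Fin 3 → ℤ} (he : Even (u 0 + u 1 + u 2)) (hu : u ≠ 0) :
    2 ≤ sqNormInt u := by
  have hpos := sqNormInt_pos hu
  -- `x² ≡ x (mod 2)`: the squared norm has the parity of the coordinate sum
  have heven : Even (sqNormInt u) := by
    have h0 := Int.even_mul_succ_self (u 0 - 1)
    have h1 := Int.even_mul_succ_self (u 1 - 1)
    have h2 := Int.even_mul_succ_self (u 2 - 1)
    have : sqNormInt u = (u 0 - 1) * (u 0 - 1 + 1) + (u 1 - 1) * (u 1 - 1 + 1)
        + (u 2 - 1) * (u 2 - 1 + 1) + (u 0 + u 1 + u 2) := by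
      unfold sqNormInt; ring
    rw [this]
    exact ((h0.add h1).add h2).add he
  obtain ⟨k, hk⟩ := heven
  omega

/-- Enumeration: the non-zero even-sum vectors of `{−1,0,1}³` with squared norm `≤ 3` are the twelve
fcc minimal vectors. [folklore] -/
theorem fccInt_enum (a b c : ℤ) (ha : -1 ≤ a) (ha' : a ≤ 1) (hb : -1 ≤ b) (hb' : b ≤ 1)
    (hc : -1 ≤ c) (hc' : c ≤ 1) (he : Even (a + b + c)) (hne : (![a, b, c] : Fin 3 → ℤ) ≠ 0) :
    (![a, b, c] : Fin 3 → ℤ) ∈ fccInt := by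
  interval_cases a <;> interval_cases b <;> interval_cases c <;>
    first | decide | exact absurd he (by decide) | exact (hne (by decide)).elim

/-- A non-zero `D₃` vector of squared norm `≤ 3` is an fcc minimal vector. [folklore] -/
theorem mem_fccInt_of_sqNormInt_le {u : Fin 3 → ℤ} (he : Even (u 0 + u 1 + u 2)) (hu : u ≠ 0)
    (h3 : sqNormInt u ≤ 3) : u ∈ fccInt := by
  unfold sqNormInt at h3
  have hu' : u = ![u 0, u 1, u 2] := by funext i; fin_cases i <;> rfl
  rw [hu'] at hu ⊢
  apply fccInt_enum _ _ _ _ _ _ _ _ _ he hu <;>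
    nlinarith [sq_nonneg (u 0), sq_nonneg (u 1), sq_nonneg (u 2)]

/-- The twelve fcc minimal vectors have even coordinate sum. [folklore] -/
theorem fccInt_even : ∀ u ∈ fccInt, Even (u 0 + u 1 + u 2) := by decide

/-- **Hard core**: distinct fcc sites are `≥ 1` apart. [cite: ConwaySloane1999, Ch. 4 §6.3] -/
theorem one_le_dist_fcc {y z : (EuclideanSpace ℝ (Fin 3))} (hy : y ∈ fccSet) (hz : z ∈ fccSet) (hne : y ≠ z) :
    1 ≤ dist y z := by
  obtain ⟨v, hv, rfl⟩ := hy
  obtain ⟨w, hw, rfl⟩ := hz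
  rw [dist_smul_intVec]
  have hvw : v - w ≠ 0 := fun h => hne (by rw [sub_eq_zero.mp h])
  have he : Even ((v - w) 0 + (v - w) 1 + (v - w) 2) := even_sum_sub hv hw
  have h2 : (2 : ℝ) ≤ (sqNormInt (v - w) : ℝ) := by exact_mod_cast two_le_sqNormInt he hvw
  rw [le_inv_mul_iff₀ (by positivity : (0 : ℝ) < Real.sqrt 2), mul_one]
  exact Real.sqrt_le_sqrt h2

/-- `fccSet` is `1`-separated (the crux's separation hypothesis). [folklore] -/
theorem fcc_separated : ∀ y ∈ fccSet, ∀ z ∈ fccSet, y ≠ z → (1 : ℝ) ≤ dist y z :=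
  fun _ hy _ hz hne => one_le_dist_fcc hy hz hne

/-- The nearest-neighbour distance of the crux, `d_y = sInf {dist z y : z ∈ S ∖ {y}}`, is `1` on
`fccSet`. [folklore] -/
theorem sInf_dist_fcc {y : (EuclideanSpace ℝ (Fin 3))} (hy : y ∈ fccSet) :
    sInf ((fun z => dist z y) '' (fccSet \ {y})) = 1 := by
  apply IsLeast.csInf_eq
  constructor
  · obtain ⟨v, hv, rfl⟩ := hy
    have hd : dist ((Real.sqrt 2)⁻¹ • intVec (v + e110) : (EuclideanSpace ℝ (Fin 3))) ((Real.sqrt 2)⁻¹ • intVec v) = 1 := by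
      rw [dist_smul_intVec, add_sub_cancel_left, sqNormInt_e110, Int.cast_ofNat,
        inv_mul_cancel₀ (by positivity : (0 : ℝ) < Real.sqrt 2).ne']
    refine ⟨(Real.sqrt 2)⁻¹ • intVec (v + e110), ⟨⟨v + e110, even_sum_add hv e110_even, rfl⟩, ?_⟩, hd⟩
    · intro h
      rw [Set.mem_singleton_iff] at h
      rw [h, dist_self] at hd
      exact zero_ne_one hd
  · rintro _ ⟨z, ⟨hz, hzy⟩, rfl⟩
    have hne : z ≠ y := fun h => hzy (Set.mem_singleton_iff.mpr h)
    simpa [dist_comm] using one_le_dist_fcc hy hz hne.symm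

/-- The first shell of the crux on `fccSet` (with `d_y = 1` substituted): exactly the translate of the fcc
kissing pattern. [cite: HalesDSP2012, §1.3] -/
theorem fcc_shell_iff {y z : (EuclideanSpace ℝ (Fin 3))} (hy : y ∈ fccSet) :
    (z ∈ fccSet ∧ z ≠ y ∧ dist z y < 13 / 10 * 1) ↔ z - y ∈ fccKissingPattern := by
  obtain ⟨v, hv, rfl⟩ := hy
  constructor
  · rintro ⟨⟨w, hw, rfl⟩, hne, hd⟩
    rw [dist_smul_intVec] at hd
    have hwv : w - v ≠ 0 := fun h => hne (by rw [sub_eq_zero.mp h])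
    have he : Even ((w - v) 0 + (w - v) 1 + (w - v) 2) := even_sum_sub hw hv
    have hlt : Real.sqrt (sqNormInt (w - v) : ℝ) < Real.sqrt 2 * (13 / 10 * 1) :=
      (inv_mul_lt_iff₀ (by positivity : (0 : ℝ) < Real.sqrt 2)).1 hd
    have h0 : (0 : ℝ) ≤ sqNormInt (w - v) := by
      have : 0 ≤ sqNormInt (w - v) := by unfold sqNormInt; positivity
      exact_mod_cast this
    have h4r : (sqNormInt (w - v) : ℝ) < 4 := by
      have hsq := Real.sq_sqrt h0
      have h2 := Real.sq_sqrt (show (0 : ℝ) ≤ 2 by norm_num)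
      have hp : 0 ≤ Real.sqrt (sqNormInt (w - v) : ℝ) := Real.sqrt_nonneg _
      have hp2 : 0 ≤ Real.sqrt 2 := Real.sqrt_nonneg _
      nlinarith
    have h4 : sqNormInt (w - v) < 4 := by exact_mod_cast h4r
    have hmem := mem_fccInt_of_sqNormInt_le he hwv (by omega)
    rw [← smul_sub, intVec_sub]
    unfold fccKissingPattern scaledPattern
    rw [Finset.mem_image]
    exact ⟨w - v, hmem, by norm_num⟩
  · intro h
    have hn : ‖z - (Real.sqrt 2)⁻¹ • intVec v‖ = 1 := norm_eq_one_of_mem_fccKissingPattern h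
    unfold fccKissingPattern scaledPattern at h
    rw [Finset.mem_image] at h
    obtain ⟨u, hu, hux⟩ := h
    simp only [Nat.cast_ofNat] at hux
    refine ⟨⟨u + v, ?_, ?_⟩, ?_, ?_⟩
    · exact even_sum_add (fccInt_even u hu) hv
    · have hadd : intVec (u + v) = intVec u + intVec v := by ext i; simp [intVec]
      rw [hadd, smul_add]
      exact (eq_sub_iff_add_eq.mp hux).symm
    · intro hzy
      rw [hzy, sub_self, norm_zero] at hn
      exact zero_ne_one hn
    · rw [dist_eq_norm, hn]; norm_num

/-- The shell-to-pattern bijection `t ↦ t − y` (the matching of the crux with `A = id`). [folklore] -/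
def fccShellEquiv {y : (EuclideanSpace ℝ (Fin 3))} (hy : y ∈ fccSet) :
    ↥({z : (EuclideanSpace ℝ (Fin 3)) | z ∈ fccSet ∧ z ≠ y ∧ dist z y < 13 / 10 * 1} : Set (EuclideanSpace ℝ (Fin 3))) ≃ ↥fccKissingPattern where
  toFun t := ⟨(t : (EuclideanSpace ℝ (Fin 3))) - y, (fcc_shell_iff hy).1 t.2⟩
  invFun p := ⟨(p : (EuclideanSpace ℝ (Fin 3))) + y, (fcc_shell_iff hy).2 (by rw [add_sub_cancel_right]; exact p.2)⟩
  left_inv t := by ext : 1; simp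
  right_inv p := by ext : 1; simp

/-- The matching moves `t` to `t − y`. [folklore] -/
theorem fccShellEquiv_apply {y : (EuclideanSpace ℝ (Fin 3))} (hy : y ∈ fccSet)
    (t : ↥({z : (EuclideanSpace ℝ (Fin 3)) | z ∈ fccSet ∧ z ≠ y ∧ dist z y < 13 / 10 * 1} : Set (EuclideanSpace ℝ (Fin 3)))) :
    ((fccShellEquiv hy t : ↥fccKissingPattern) : (EuclideanSpace ℝ (Fin 3))) = (t : (EuclideanSpace ℝ (Fin 3))) - y := rfl

/-- **Every fcc site is `1/20`-fcc-good**, hence good in the enlarged alphabet: the crux's inline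
goodness predicate `GA`, verbatim with `S := fccSet` (matching: `A = id`, `e : t ↦ t − y`, error `0`).
[cite: HalesDSP2012, §1.3] -/
theorem fcc_good : ∀ y ∈ fccSet, (let d : ℝ := sInf ((fun z => dist z y) '' (fccSet \ {y})); let T : Set (EuclideanSpace ℝ (Fin 3)) := {z : EuclideanSpace ℝ (Fin 3) | z ∈ fccSet ∧ z ≠ y ∧ dist z y < 13 / 10 * d}; ∃ A : EuclideanSpace ℝ (Fin 3) →ₗᵢ[ℝ] EuclideanSpace ℝ (Fin 3), (∃ e : ↥T ≃ ↥Literature.Geometry.DiscreteGeometry.fccKissingPattern, ∀ t : ↥T, dist (d⁻¹ • ((t : EuclideanSpace ℝ (Fin 3)) - y)) (A ((e t : ↥Literature.Geometry.DiscreteGeometry.fccKissingPattern) : EuclideanSpace ℝ (Fin 3))) ≤ 1 / 20) ∨ (∃ e : ↥T ≃ ↥Literature.Geometry.DiscreteGeometry.hcpKissingPattern, ∀ t : ↥T, dist (d⁻¹ • ((t : EuclideanSpace ℝ (Fin 3)) - y)) (A ((e t : ↥Literature.Geometry.DiscreteGeometry.hcpKissingPattern) : EuclideanSpace ℝ (Fin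 3))) ≤ 1 / 20) ∨ (∃ e : ↥T ≃ ↥{p : EuclideanSpace ℝ (Fin 3) | p = !₂[(0 : ℝ), 0, 1] ∨ p = !₂[(0 : ℝ), 0, -1] ∨ ∃ k : Fin 5, ∃ σ : ℝ, (σ = 1 / 2 ∨ σ = -(1 / 2)) ∧ p = !₂[Real.sqrt 3 / 2 * Real.cos (2 * Real.pi * (k : ℝ) / 5), Real.sqrt 3 / 2 * Real.sin (2 * Real.pi * (k : ℝ) / 5), σ]}, ∀ t : ↥T, dist (d⁻¹ • ((t : EuclideanSpace ℝ (Fin 3)) - y)) (A ((e t : ↥{p : EuclideanSpace ℝ (Fin 3) | p = !₂[(0 : ℝ), 0, 1] ∨ p = !₂[(0 : ℝ), 0, -1] ∨ ∃ k : Fin 5, ∃ σ : ℝ, (σ = 1 / 2 ∨ σ = -(1 / 2)) ∧ p = !₂[Real.sqrt 3 / 2 * Real.cos (2 * Real.pi * (k : ℝ) / 5), Real.sqrt 3 / 2 * Real.sin (2 * Real.pi * (k : ℝ) / 5), σ]}) : EuclideanSpace ℝ (Fin 3))) ≤ 1 / 20)) := by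
  intro y hy
  show ∃ A : (EuclideanSpace ℝ (Fin 3)) →ₗᵢ[ℝ] (EuclideanSpace ℝ (Fin 3)), _
  rw [sInf_dist_fcc hy]
  refine ⟨LinearIsometry.id, Or.inl ⟨fccShellEquiv hy, fun t => ?_⟩⟩
  rw [fccShellEquiv_apply]
  simp

/-- **`fccSet` is relatively dense** (covering radius `≤ 3`): round `√2·p` coordinatewise to even
integers. [folklore] -/
theorem fcc_relDense : ∀ p : (EuclideanSpace ℝ (Fin 3)), ∃ y ∈ fccSet, dist y p ≤ 3 := by
  intro p
  refine ⟨(Real.sqrt 2)⁻¹ • intVec (fun i => 2 * ⌊Real.sqrt 2 * p i / 2⌋),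
    ⟨fun i => 2 * ⌊Real.sqrt 2 * p i / 2⌋, ⟨⌊Real.sqrt 2 * p 0 / 2⌋ + ⌊Real.sqrt 2 * p 1 / 2⌋
      + ⌊Real.sqrt 2 * p 2 / 2⌋, by ring⟩, rfl⟩, ?_⟩
  have key : ∀ i : Fin 3,
      dist (((Real.sqrt 2)⁻¹ • intVec (fun i => 2 * ⌊Real.sqrt 2 * p i / 2⌋) : (EuclideanSpace ℝ (Fin 3))) i) (p i) ^ 2 ≤ 3 := by
    intro i
    have h1 := Int.floor_le (Real.sqrt 2 * p i / 2)
    have h2 := Int.lt_floor_add_one (Real.sqrt 2 * p i / 2)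
    have hs : Real.sqrt 2 * Real.sqrt 2 = 2 := Real.mul_self_sqrt (by norm_num)
    have hs0 : 0 < Real.sqrt 2 := (by positivity : (0 : ℝ) < Real.sqrt 2)
    rw [Real.dist_eq, sq_abs]
    simp only [PiLp.smul_apply, intVec_apply, smul_eq_mul]
    push_cast
    set f : ℝ := (⌊Real.sqrt 2 * p i / 2⌋ : ℝ) with hf
    have hrew : (Real.sqrt 2)⁻¹ * (2 * f) - p i = (Real.sqrt 2)⁻¹ * (2 * f - Real.sqrt 2 * p i) := by
      field_simp
    rw [hrew, mul_pow, inv_pow, Real.sq_sqrt (by norm_num : (0 : ℝ) ≤ 2)]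
    have hb : (2 * f - Real.sqrt 2 * p i) ^ 2 ≤ 4 := by nlinarith
    linarith
  rw [EuclideanSpace.dist_eq]
  calc Real.sqrt (∑ i, dist (((Real.sqrt 2)⁻¹ • intVec (fun i => 2 * ⌊Real.sqrt 2 * p i / 2⌋) : (EuclideanSpace ℝ (Fin 3))) i) (p i) ^ 2)
      ≤ Real.sqrt 9 := by
        apply Real.sqrt_le_sqrt
        rw [Fin.sum_univ_three]
        linarith [key 0, key 1, key 2]
    _ = 3 := by
        rw [show (9 : ℝ) = 3 ^ 2 by norm_num, Real.sqrt_sq (by norm_num)]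

/-! ### The registered stub `stub_dr5_shellMutual` (line `Sketch`) is false as typed -/

/-- VERBATIM copy of `Sig.stub_dr5_shellMutual` of the lead's registered skeleton
`Cruxes/FiveFoldRation/Lines/Sketch.lean` (2026-08-17T14:23Z), i.e. the statement of its
`stub_dr5_shellMutual` (shell symmetry + scale comparability, FRONT END 1).  NOTE the binder
`fun z => dist z z` in the last two conjuncts: it shadows `z`, so that `sInf` is over the constant `0`.
A stub statement restated for target analysis (Negative/ lane), not a literature fact. -/
def StubShellMutualSig : Prop :=
  ∀ δ : ℝ, 0 < δ → ∀ S : Set (EuclideanSpace ℝ (Fin 3)), (∀ y ∈ S, ∀ z ∈ S, y ≠ z → δ ≤ dist y z) → (∃ R₁ : ℝ, ∀ p : EuclideanSpace ℝ (Fin 3), ∃ y ∈ S, dist y p ≤ R₁) → (∀ y ∈ S, (let d : ℝ := sInf ((fun z => dist z y) '' (S \ {y})); let T : Set (EuclideanSpace ℝ (Fin 3)) := {z : EuclideanSpace ℝ (Fin 3) | z ∈ S ∧ z ≠ y ∧ dist z y < 13 / 10 * d}; ∃ A : EuclideanSpace ℝ (Fin 3) →ₗᵢ[ℝ] EuclideanSpace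 ℝ (Fin 3), (∃ e : ↥T ≃ ↥Literature.Geometry.DiscreteGeometry.fccKissingPattern, ∀ t : ↥T, dist (d⁻¹ • ((t : EuclideanSpace ℝ (Fin 3)) - y)) (A ((e t : ↥Literature.Geometry.DiscreteGeometry.fccKissingPattern) : EuclideanSpace ℝ (Fin 3))) ≤ 1 / 20) ∨ (∃ e : ↥T ≃ ↥Literature.Geometry.DiscreteGeometry.hcpKissingPattern, ∀ t : ↥T, dist (d⁻¹ • ((t : EuclideanSpace ℝ (Fin 3)) - y)) (A ((e t : ↥Literature.Geometry.DiscreteGeometry.hcpKissingPattern) : EuclideanSpace ℝ (Fin 3))) ≤ 1 / 20) ∨ (∃ e : ↥T ≃ ↥{p : EuclideanSpace ℝ (Fin 3) | p = !₂[(0 : ℝ), 0, 1] ∨ p = !₂[(0 : ℝ), 0, -1] ∨ ∃ k : Fin 5, ∃ σ : ℝ, (σ = 1 / 2 ∨ σ = -(1 / 2)) ∧ p = !₂[Real.sqrt 3 / 2 * Real.cos (2 * Real.pi * (k : ℝ) / 5), Real.sqrt 3 / 2 * Real.sin (2 * Real.pi * (k : ℝ) / 5), σ]}, ∀ t : ↥T,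 dist (d⁻¹ • ((t : EuclideanSpace ℝ (Fin 3)) - y)) (A ((e t : ↥{p : EuclideanSpace ℝ (Fin 3) | p = !₂[(0 : ℝ), 0, 1] ∨ p = !₂[(0 : ℝ), 0, -1] ∨ ∃ k : Fin 5, ∃ σ : ℝ, (σ = 1 / 2 ∨ σ = -(1 / 2)) ∧ p = !₂[Real.sqrt 3 / 2 * Real.cos (2 * Real.pi * (k : ℝ) / 5), Real.sqrt 3 / 2 * Real.sin (2 * Real.pi * (k : ℝ) / 5), σ]}) : EuclideanSpace ℝ (Fin 3))) ≤ 1 / 20))) → ∀ y ∈ S, ∀ z ∈ S, z ≠ y → dist z y < 13 / 10 * sInf ((fun z => dist z y) '' (S \ {y})) → sInf ((fun z => dist z y) '' (S \ {y})) ≤ dist z y ∧ dist z y ≤ 21 / 20 * sInf ((fun z => dist z y) '' (S \ {y})) ∧ dist y z < 13 / 10 * sInf ((fun z => dist z z) '' (S \ {z})) ∧ dist y z ≤ 21 / 20 * sInf ((fun z => dist z z) '' (S \ {z}))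

/-- The captured "nearest-neighbour distance at `z`" of the stub is identically `0`. [folklore] -/
theorem sInf_capture (S : Set (EuclideanSpace ℝ (Fin 3))) (z : (EuclideanSpace ℝ (Fin 3))) : sInf ((fun z => dist z z) '' (S \ {z})) = 0 := by
  have h : (fun z : (EuclideanSpace ℝ (Fin 3)) => dist z z) = fun _ => (0 : ℝ) := by funext w; simp
  rw [h]
  rcases (S \ {z}).eq_empty_or_nonempty with h1 | h1
  · rw [h1, Set.image_empty]; exact Real.sInf_empty
  · rw [h1.image_const]; exact csInf_singleton 0

/-- **`stub_dr5_shellMutual` is FALSE as registered** (stub-misstated by variable capture): on the fcc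
lattice (`δ = 1`, covering radius `3`, every site `1/20`-fcc-good) the pair `y = 0`, `z = (1,1,0)/√2` is a
shell pair, and the stub's third conclusion reads `dist y z < 13/10 · 0`.  Repair: write the scale at `z`
as `sInf ((fun w => dist w z) '' (S ∖ {z}))`. [folklore] -/
theorem stub_dr5_shellMutual_false : ¬ StubShellMutualSig := by
  intro h
  have hy : ((Real.sqrt 2)⁻¹ • intVec 0 : (EuclideanSpace ℝ (Fin 3))) ∈ fccSet := ⟨0, by simp, rfl⟩
  have hz : ((Real.sqrt 2)⁻¹ • intVec e110 : (EuclideanSpace ℝ (Fin 3))) ∈ fccSet := ⟨e110, e110_even, rfl⟩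
  have hd : dist ((Real.sqrt 2)⁻¹ • intVec e110 : (EuclideanSpace ℝ (Fin 3))) ((Real.sqrt 2)⁻¹ • intVec 0) = 1 := by
    rw [dist_smul_intVec, sub_zero, sqNormInt_e110, Int.cast_ofNat, inv_mul_cancel₀ (by positivity : (0 : ℝ) < Real.sqrt 2).ne']
  have hne : ((Real.sqrt 2)⁻¹ • intVec e110 : (EuclideanSpace ℝ (Fin 3))) ≠ (Real.sqrt 2)⁻¹ • intVec 0 := by
    intro he
    rw [he, dist_self] at hd
    exact zero_ne_one hd
  have hlt : dist ((Real.sqrt 2)⁻¹ • intVec e110 : (EuclideanSpace ℝ (Fin 3))) ((Real.sqrt 2)⁻¹ • intVec 0)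
      < 13 / 10 * sInf ((fun z => dist z ((Real.sqrt 2)⁻¹ • intVec 0 : (EuclideanSpace ℝ (Fin 3)))) '' (fccSet \ {(Real.sqrt 2)⁻¹ • intVec 0})) := by
    rw [sInf_dist_fcc hy, hd]; norm_num
  obtain ⟨-, -, h3, -⟩ := h 1 one_pos fccSet fcc_separated ⟨3, fcc_relDense⟩ fcc_good _ hy _ hz hne hlt
  rw [sInf_capture] at h3
  linarith [dist_nonneg (x := ((Real.sqrt 2)⁻¹ • intVec 0 : (EuclideanSpace ℝ (Fin 3)))) (y := ((Real.sqrt 2)⁻¹ • intVec e110 : (EuclideanSpace ℝ (Fin 3))))]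

end Summit.AtomisticToContinuum.Crystallization.Theorems.FiveFoldRation.Negative

end
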